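import Summits.CriticalPhenomena.PercolationContinuityZ3.Theorems.FK.FreeBoxLimitMixing
import Summits.CriticalPhenomena.PercolationContinuityZ3.Theorems.FK.InfiniteVolumeInvariance
import Summits.CriticalPhenomena.PercolationContinuityZ3.Theorems.FK.InfiniteVolumeFKG
import Summits.CriticalPhenomena.PercolationContinuityZ3.Theorems.FK.InfiniteVolumeFiniteEnergy
import Summits.CriticalPhenomena.PercolationContinuityZ3.Theorems.FK.UniquenessInfiniteClusterFK
import Summits.CriticalPhenomena.PercolationContinuityZ3.Theorems.FK.InfiniteVolumeDLR
import Summits.CriticalPhenomena.PercolationContinuityZ3.Theorems.FK.ContinuityTransferTwo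
import HarnessLib

/-!
# The free FK–Ising measure `φ⁰_{p,2} = rcLimit d false (1 - e^{-2β}) 2`: Edwards–Sokal two-point
# identity, no three infinite clusters, and `θ⁰(p,2)² ≤ 2·M̃_LRO(β)²` — unconditionally

fk-continuity build cell, row FO-03b‴ (`--supports stmt-CriticalPhenomena-4575`, helper); builds on p205010
(kernel theorem, internal audit signed; external expert review pending). Sorry-free, standard axioms, no
named facts, no new definitions.

The files `FreeEdwardsSokalTwoPoint.lean`, `FreeEdwardsSokalLROIdentity.lean`, `FreeEdwardsSokalPointwise.lean`
and `FreeBoxLimitMixing.lean` prove the infinite-volume Edwards–Sokal dictionary and Grimmett 2006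
(5.18)/(5.32) at `q = 2` for ANY free FK–Ising box limit `P` under named hypotheses (support, translation
invariance, insertion tolerance, DLR sandwich, a.s. uniqueness of the infinite cluster). This file discharges,
for THE free measure `φ⁰_{p,2} = rcLimit d false p 2`, `p = fkIsingParam β = 1 - e^{-2β}`, every hypothesis
that the cell's construction files already in the tree provide — `isBoxLimit_rcLimit` (Thm. (4.19)(a)),
`IsBoxLimit.ae_subset_edgeSet` (support), `IsBoxLimit.measurePreserving_relabel_shift` (Thm. (4.19)(b)),
`IsBoxLimit.insertion_tolerant` (finite energy, Thm. (4.17)(a)/(3.4)), `IsBoxLimit.real_percolatesAt_eq_thetaFree`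
((5.1)) — and nothing else (no DLR sandwich, no Burton–Keane zero–one law):

* `FK.rcLimit_real_openConn_eq_freePair` — **`φ⁰_{p,2}(x ↔ y) = ⟨σ_xσ_y⟩^∅_{β,0}`** (Thm. (4.91); first display
  of the proof of (5.18), p. 107);
* `FK.IsBoxLimit.measure_threeInfClusters_eq_zero`, `FK.rcLimit_threeInfClusters_eq_zero` — **`φ^b_{p,q}`-a.s.
  there are not three (or more) infinite clusters** (`d ≥ 1`, `0 < p ≤ 1`, `q ≥ 1`, both `b`), by the
  Burton–Keane trifurcation count in the ergodicity-free form of Bollobás–Riordan 2006, Ch. 5 Thm. 4 (the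
  tree's `measure_threeInfClusters_eq_zero_of_invariant`): translation invariance + insertion tolerance only;
* **`FK.thetaFree_sq_le_two_mul_lroTildeSq` — `θ⁰(1 - e^{-2β}, 2)² ≤ 2·M̃_LRO(β)²`** (`d ≥ 1`, `β ≥ 0`):
  Aizenman–Duminil-Copin–Sidoravicius 2015, Thm. 3.1 (the two-cluster density bound) for `φ⁰_{p,2}`, read
  through Edwards–Sokal; the factor `2` disappears under a.s. uniqueness (row FO-08) and becomes the equality
  (5.18) `M̃_LRO(β)² = θ⁰(p,2)²` with the DLR sandwich (row FO-06a-2) — appended to this file when those land;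
* `FK.rcLimit_percolatesAt_eq_zero_of_lroTildeSq_eq_zero` — **`M̃_LRO(β) = 0 ⇒ φ⁰_{p,2}(x ↔ ∞) = 0` for every
  `x`**: the half '⇐' of the zero form of (5.18) by ADS15's own route (Thm. 3.1), independently of the route
  through ADS15 Thm. 1.2 / (5.19) used in `ContinuityTransferTwo.lean` (`FK.thetaFree_eq_zero_of_lroTildeSq_eq_zero`).

## References

* G. Grimmett, *The Random-Cluster Model*, Springer 2006: Thm. (4.17)(a), Thm. (4.19)(a)–(b), Thm. (4.33)(c),
  Thm. (4.91), §5.1 (5.1), Thm. (5.17) with eq. (5.18) and its proof, (5.32), p. 107. [Grimmett2006]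
* M. Aizenman, H. Duminil-Copin, V. Sidoravicius, Comm. Math. Phys. 334 (2015) 719–742, §1.3 (1.9), Thm. 3.1
  and §3.2. [AizenmanDuminilCopinSidoraviciusCMP2015]
* B. Bollobás, O. Riordan, *Percolation*, CUP 2006, Ch. 5, Thm. 4 (pp. 107–109). [BollobasRiordan2006]
-/

noncomputable section

namespace Summit.CriticalPhenomena.PercolationContinuityZ3.Theorems

namespace FK

open MeasureTheory Filter Topology Function
open Literature.Probability.LatticeModels Literature.Barriers.CriticalPhenomena
open Literature.Probability.Percolation

variable {d : ℕ}

/-! ### No three infinite clusters under `φ^b_{p,q}` — translation invariance and finite energy only -/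

section NoThreeClusters

variable {b : Bool} {p q : ℝ} {P : Measure (BondConfig (Site d))}

/-- **No three infinite clusters, for every random-cluster box limit** (`d ≥ 1`, `0 < p ≤ 1`, `q ≥ 1`,
free or wired): `P`-almost surely a configuration does not contain three distinct infinite open clusters.
This is the part of Grimmett 2006 Thm. (4.33)(c) (Burton–Keane uniqueness for `φ^b_{p,q}`) that needs
neither the DLR property nor ergodicity: the trifurcation/cut-ball count of Bollobás–Riordan 2006, Ch. 5
Thm. 4 uses only that `P` is carried by nearest-neighbour configurations, is translation invariant
(Thm. (4.19)(b)) and is insertion tolerant on boxes (finite energy, Thm. (4.17)(a)).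
[cite: Grimmett2006, Thm. (4.33)(c), with Thm. (4.17)(a) and Thm. (4.19)(b)] [cite: BollobasRiordan2006, Ch. 5, Thm. 4 (pp. 107–109)] -/
theorem IsBoxLimit.measure_threeInfClusters_eq_zero (hP : IsBoxLimit d b p q P) (hd : 1 ≤ d)
    (hp : p ∈ Set.Ioc (0 : ℝ) 1) (hq : 1 ≤ q) : P (threeInfClusters (Site d)) = 0 := by
  haveI := hP.isProbabilityMeasure
  have hp' : p ∈ Set.Icc (0 : ℝ) 1 := ⟨hp.1.le, hp.2⟩
  refine measure_threeInfClusters_eq_zero_of_invariant hd P (hP.ae_subset_edgeSet hp' (one_pos.trans_le hq))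
    (hP.measurePreserving_relabel_shift hp' hq) fun n => ?_
  obtain ⟨c, hc, h⟩ := hP.insertion_tolerant hp hq n
  exact ⟨c, hc, fun E hE => h hE⟩

/-- **No three infinite clusters under `φ^b_{p,q} = rcLimit d b p q`** (`d ≥ 1`, `0 < p ≤ 1`, `q ≥ 1`).
[cite: Grimmett2006, Thm. (4.33)(c)] [cite: BollobasRiordan2006, Ch. 5, Thm. 4 (pp. 107–109)] -/
theorem rcLimit_threeInfClusters_eq_zero (b : Bool) (hd : 1 ≤ d) (hp : p ∈ Set.Ioc (0 : ℝ) 1)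
    (hq : 1 ≤ q) : rcLimit d b p q (threeInfClusters (Site d)) = 0 :=
  (isBoxLimit_rcLimit b ⟨hp.1.le, hp.2⟩ hq).measure_threeInfClusters_eq_zero hd hp hq

end NoThreeClusters

/-! ### The free FK–Ising measure `φ⁰_{p,2}`, `p = 1 - e^{-2β}` -/

section IsingFree

variable {β : ℝ}

/-- **`φ⁰_{p,2}(x ↔ y) = ⟨σ_xσ_y⟩^∅_{β,0}`** for the infinite-volume free FK–Ising measure
`φ⁰_{p,2} = rcLimit d false p 2`, `p = 1 - e^{-2β}`, `β ≥ 0` (Grimmett 2006, Thm. (4.91); first display of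
the proof of (5.18), p. 107): `IsBoxLimit.real_openConn_eq_freePair` for the canonical limit.
[cite: Grimmett2006, Thm. (4.91) and Thm. (5.17), proof of (5.18), p. 107] -/
theorem rcLimit_real_openConn_eq_freePair (hβ : 0 ≤ β) (x y : Site d) :
    (rcLimit d false (fkIsingParam β) 2).real (openConn x y) = freePair d β x y :=
  (isBoxLimit_rcLimit false (fkIsingParam_mem_Icc hβ) (by norm_num)).real_openConn_eq_freePair hβ x y

/-- `1 - e^{-2β} > 0` for `β > 0`. [cite: Grimmett2006, Thm. (4.91) (p = 1 - e^{-2β})] -/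
theorem fkIsingParam_mem_Ioc_of_pos (hβ : 0 < β) : fkIsingParam β ∈ Set.Ioc (0 : ℝ) 1 :=
  ⟨sub_pos.2 (Real.exp_lt_one_iff.2 (by linarith)), (fkIsingParam_mem_Icc hβ.le).2⟩

/-- **`θ⁰(1 - e^{-2β}, 2)² ≤ 2·M̃_LRO(β)²` on `ℤ^d`, `d ≥ 1`, `β ≥ 0`, unconditionally** —
Aizenman–Duminil-Copin–Sidoravicius 2015, Thm. 3.1 (if a translation-invariant measure a.s. has at most two
infinite clusters then `|B|⁻² ∑_{x,y ∈ B} P(x ↔ y) ≥ P(0 ↔ ∞)²/2` for every finite `B`) applied to the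
free FK–Ising measure `φ⁰_{p,2}`, whose connectivities are the free Ising correlations (Thm. (4.91)) and
whose percolation probability is `θ⁰(p,2)` ((5.1)); 'no three infinite clusters' is
`IsBoxLimit.measure_threeInfClusters_eq_zero` (translation invariance + finite energy). For `β = 0` both
sides vanish trivially (`p = 0`). Under a.s. uniqueness of the infinite cluster the factor `2` drops and
(5.18) gives equality. [cite: AizenmanDuminilCopinSidoraviciusCMP2015, Thm. 3.1 and §1.3 eq. (1.9)] [cite: Grimmett2006, Thm. (4.91), §5.1 (5.1), Thm. (5.17) eq. (5.18)] -/
theorem thetaFree_sq_le_two_mul_lroTildeSq (hd : 1 ≤ d) (hβ : 0 ≤ β) :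
    thetaFree d (fkIsingParam β) 2 ^ 2 ≤ 2 * lroTildeSq d β := by
  have hq : (1 : ℝ) ≤ 2 := by norm_num
  rcases hβ.eq_or_lt with h0 | hβ'
  · subst h0
    have h00 : fkIsingParam 0 = 0 := by simp [fkIsingParam]
    rw [h00, thetaFree_zero_left' d hq, sq, mul_zero]
    exact mul_nonneg zero_le_two (lroTildeSq_nonneg le_rfl)
  · have hp := fkIsingParam_mem_Icc hβ
    have hP := isBoxLimit_rcLimit false hp hq (d := d)
    rw [← hP.real_percolatesAt_eq_thetaFree hp hq]
    exact hP.sq_real_percolatesAt_le_two_mul_lroTildeSq hβ (hP.measurePreserving_relabel_shift hp hq)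
      (hP.measure_threeInfClusters_eq_zero hd (fkIsingParam_mem_Ioc_of_pos hβ') hq)

/-- Square-root form: **`θ⁰(1 - e^{-2β}, 2) ≤ √2 · M̃_LRO(β)`** (`d ≥ 1`, `β ≥ 0`), where
`M̃_LRO(β) = √(lroTildeSq d β)`. [cite: AizenmanDuminilCopinSidoraviciusCMP2015, Thm. 3.1 and §1.3 eq. (1.9)] -/
theorem thetaFree_le_sqrt_two_mul_lroTildeSq (hd : 1 ≤ d) (hβ : 0 ≤ β) :
    thetaFree d (fkIsingParam β) 2 ≤ Real.sqrt (2 * lroTildeSq d β) := by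
  rw [← Real.sqrt_sq (thetaFree_nonneg _ _)]
  exact Real.sqrt_le_sqrt (thetaFree_sq_le_two_mul_lroTildeSq hd hβ)

/-- **`M̃_LRO(β) = 0 ⇒ φ⁰_{p,2}(x ↔ ∞) = 0` for every site `x`** (`d ≥ 1`, `β ≥ 0`, `p = 1 - e^{-2β}`):
ADS15 §3.2 ("applying Theorem 3.1 we conclude that `ℙ_β[x ↔ ∞] = 0`") for the free FK–Ising measure —
from `thetaFree_sq_le_two_mul_lroTildeSq`, (5.1) and translation invariance; this is the half '⇐' of the
zero form of Grimmett's (5.18) by the two-cluster density bound, with no appeal to ADS15 Thm. 1.2, the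
DLR property or the Burton–Keane zero–one law. [cite: AizenmanDuminilCopinSidoraviciusCMP2015, Thm. 3.1 and §3.2] [cite: Grimmett2006, Thm. (5.17) eq. (5.18) and §5.1 (5.1)] -/
theorem rcLimit_percolatesAt_eq_zero_of_lroTildeSq_eq_zero (hd : 1 ≤ d) (hβ : 0 ≤ β)
    (h0 : lroTildeSq d β = 0) (x : Site d) :
    rcLimit d false (fkIsingParam β) 2 (percolatesAt x) = 0 := by
  have hp := fkIsingParam_mem_Icc hβ
  have hq : (1 : ℝ) ≤ 2 := by norm_num
  have hP := isBoxLimit_rcLimit false hp hq (d := d)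
  haveI := hP.isProbabilityMeasure
  have hθ : thetaFree d (fkIsingParam β) 2 = 0 := by
    have h := thetaFree_sq_le_two_mul_lroTildeSq hd hβ
    rw [h0, mul_zero] at h
    exact (pow_eq_zero_iff two_ne_zero).1 (le_antisymm h (sq_nonneg _))
  rw [← measureReal_eq_zero_iff,
    measureReal_percolatesAt_eq_of_invariant _ (hP.measurePreserving_relabel_shift hp hq) x,
    hP.real_percolatesAt_eq_thetaFree hp hq, hθ]

/-- Zero form packaged for the canonical free measure: **`M̃_LRO(β)² = 0 ↔ φ⁰_{p,2}(0 ↔ ∞) = 0`**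
(`d ≥ 1`, `β ≥ 0`); '←' is row FO-03a (`lroTildeSq_le_thetaFree`, finite-volume Edwards–Sokal + Cesàro)
read through (5.1). [cite: Grimmett2006, Thm. (5.17) eq. (5.18), §5.1 (5.1)] [cite: AizenmanDuminilCopinSidoraviciusCMP2015, Thm. 3.1, §1.3 eq. (1.9)] -/
theorem lroTildeSq_eq_zero_iff_rcLimit_percolatesAt_eq_zero (hd : 1 ≤ d) (hβ : 0 ≤ β) :
    lroTildeSq d β = 0 ↔ rcLimit d false (fkIsingParam β) 2 (percolatesAt (0 : Site d)) = 0 := by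
  refine ⟨fun h0 => rcLimit_percolatesAt_eq_zero_of_lroTildeSq_eq_zero hd hβ h0 0, fun h => ?_⟩
  have hp := fkIsingParam_mem_Icc hβ
  have hq : (1 : ℝ) ≤ 2 := by norm_num
  have hθ : thetaFree d (fkIsingParam β) 2 = 0 :=
    ((isBoxLimit_rcLimit false hp hq).measure_percolatesAt_eq_zero_iff_thetaFree hp hq).1 h
  exact lroTildeSq_eq_zero_of_thetaFree_eq_zero hd hβ hθ

end IsingFree

/-! ### (5.18) at `q = 2` over a free FK–Ising box limit, modulo the DLR sandwich only (appended)

With `UniquenessInfiniteClusterFK.lean` (row FO-08: `IsBoxLimit.ae_numInfiniteClusters_le_one`, Burton–Keane for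
box limits with the FK Gibbs property), `InfiniteVolumeInvariance.lean` (Thm. (4.19)(b)) and `InfiniteVolumeFKG.lean`
(Thm. (4.17)(b)) in the tree, every hypothesis of the LRO identity of `FreeBoxLimitMixing.lean` except the DLR
sandwich `FKGibbs d p 2 P` is discharged for an arbitrary free FK–Ising box limit `P`. For the canonical
`P = φ⁰_{p,2} = rcLimit d false p 2` the remaining hypothesis is the cell's `IsBoxLimit.fkGibbs` (row FO-06a-2,
Grimmett 2006 Lemma (4.13) with (4.14)(b) in the limit); the hypothesis-free forms are appended below it once
that file is in the tree. -/

section ModuloDLR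

variable {β : ℝ} {P : Measure (BondConfig (Site d))}

/-- **`M̃_LRO(β)² ≤ θ⁰(1 - e^{-2β}, 2)²`, the upper half of (5.18), for a free FK–Ising box limit with the
DLR sandwich property** (`d ≥ 1`, `β ≥ 0`): translation invariance (Thm. (4.19)(b),
`IsBoxLimit.measurePreserving_relabel_shift`) is discharged; uniqueness is not needed for this half.
[cite: Grimmett2006, Thm. (5.17), proof of (5.18), (5.32), p. 107, with Thm. (4.19)(b) and Cor. (4.23)] -/
theorem IsBoxLimit.lroTildeSq_le_thetaFree_sq_of_fkGibbs (hP : IsBoxLimit d false (fkIsingParam β) 2 P)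
    (hd : 1 ≤ d) (hβ : 0 ≤ β) (hG : FKGibbs d (fkIsingParam β) 2 P) :
    lroTildeSq d β ≤ thetaFree d (fkIsingParam β) 2 ^ 2 :=
  hP.lroTildeSq_le_thetaFree_sq hd hβ hG
    (hP.measurePreserving_relabel_shift (fkIsingParam_mem_Icc hβ) (by norm_num))

/-- **`θ⁰(1 - e^{-2β}, 2)² ≤ M̃_LRO(β)²`, the lower half of (5.18), for a free FK–Ising box limit with the
DLR sandwich property** (`β ≥ 0`): translation invariance (Thm. (4.19)(b)) and a.s. uniqueness of the
infinite cluster (Thm. (4.33)(c), `IsBoxLimit.ae_numInfiniteClusters_le_one`, row FO-08) are discharged.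
[cite: Grimmett2006, Thm. (5.17), proof of (5.18), (5.32), p. 107, with Thm. (4.19)(b) and Thm. (4.33)(c)] [cite: AizenmanDuminilCopinSidoraviciusCMP2015, Thm. 3.1] -/
theorem IsBoxLimit.thetaFree_sq_le_lroTildeSq_of_fkGibbs (hP : IsBoxLimit d false (fkIsingParam β) 2 P)
    (hβ : 0 ≤ β) (hG : FKGibbs d (fkIsingParam β) 2 P) :
    thetaFree d (fkIsingParam β) 2 ^ 2 ≤ lroTildeSq d β :=
  have hp := fkIsingParam_mem_Icc hβ
  hP.thetaFree_sq_le_lroTildeSq hβ (hP.measurePreserving_relabel_shift hp (by norm_num))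
    (hP.ae_numInfiniteClusters_le_one hG hp (by norm_num))

/-- **`M̃_LRO(β)² = θ⁰(1 - e^{-2β}, 2)²` — Grimmett 2006 Thm. (5.17) eq. (5.18) at `q = 2` (Cesàro
normalisation of ADS15 §1.3) for every free FK–Ising box limit with the DLR sandwich property** (`d ≥ 1`,
`β ≥ 0`); for `P = φ⁰_{p,2}` the one remaining hypothesis is Lemma (4.13)/(4.14)(b) in the limit
(`IsBoxLimit.fkGibbs`, row FO-06a-2).
[cite: Grimmett2006, Thm. (5.17), eq. (5.18), p. 102 (proof p. 107)] [cite: AizenmanDuminilCopinSidoraviciusCMP2015, §1.3, eq. (1.9)] -/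
theorem IsBoxLimit.lroTildeSq_eq_thetaFree_sq_of_fkGibbs (hP : IsBoxLimit d false (fkIsingParam β) 2 P)
    (hd : 1 ≤ d) (hβ : 0 ≤ β) (hG : FKGibbs d (fkIsingParam β) 2 P) :
    lroTildeSq d β = thetaFree d (fkIsingParam β) 2 ^ 2 :=
  le_antisymm (hP.lroTildeSq_le_thetaFree_sq_of_fkGibbs hd hβ hG) (hP.thetaFree_sq_le_lroTildeSq_of_fkGibbs hβ hG)

/-- **`θ⁰(1 - e^{-2β}, 2)² ≤ ⟨σ_xσ_y⟩^∅_{β,0}` for all `x, y`** (`β ≥ 0`), the lower half of (5.32) pointwise,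
for a free FK–Ising box limit with the DLR sandwich property: positive association (Thm. (4.17)(b),
`IsBoxLimit.isPositivelyAssociated`), translation invariance and a.s. uniqueness are discharged.
[cite: Grimmett2006, Thm. (5.17), proof of (5.18), (5.32), p. 107, with Thm. (4.17)(b), (4.19)(b), (4.33)(c)] -/
theorem IsBoxLimit.thetaFree_sq_le_freePair_of_fkGibbs (hP : IsBoxLimit d false (fkIsingParam β) 2 P)
    (hβ : 0 ≤ β) (hG : FKGibbs d (fkIsingParam β) 2 P) (x y : Site d) :
    thetaFree d (fkIsingParam β) 2 ^ 2 ≤ freePair d β x y :=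
  have hp := fkIsingParam_mem_Icc hβ
  have hq : (1 : ℝ) ≤ 2 := by norm_num
  hP.thetaFree_sq_le_freePair hβ (hP.isPositivelyAssociated hp hq) (hP.measurePreserving_relabel_shift hp hq)
    (hP.ae_numInfiniteClusters_le_one hG hp hq) x y

/-- **Grimmett 2006, Thm. (5.17) eq. (5.18) at `q = 2`, literally: `⟨σ_0σ_u⟩^∅_{β,0} → θ⁰(1 - e^{-2β}, 2)²`
as `|u| → ∞`** (`β ≥ 0`; `½ θ⁰(p,2)² = lim_{|u|→∞} {π_β(σ_0 = σ_u) - ½}`), for a free FK–Ising box limit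
with the DLR sandwich property (translation invariance and a.s. uniqueness discharged).
[cite: Grimmett2006, Thm. (5.17), eq. (5.18) and its proof, (5.32), p. 107] -/
theorem IsBoxLimit.tendsto_twoPointFree_cofinite_of_fkGibbs (hP : IsBoxLimit d false (fkIsingParam β) 2 P)
    (hβ : 0 ≤ β) (hG : FKGibbs d (fkIsingParam β) 2 P) :
    Tendsto (twoPointFree d β) cofinite (𝓝 (thetaFree d (fkIsingParam β) 2 ^ 2)) :=
  have hp := fkIsingParam_mem_Icc hβ
  hP.tendsto_twoPointFree_cofinite hβ hG (hP.measurePreserving_relabel_shift hp (by norm_num))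
    (hP.ae_numInfiniteClusters_le_one hG hp (by norm_num))

/-- Pair-correlation form at a base point `x`: `⟨σ_xσ_{x+u}⟩^∅_{β,0} = freePair d β x (x + u) → θ⁰(p,2)²`
as `|u| → ∞`, for a free FK–Ising box limit with the DLR sandwich property (`freePair_eq_twoPointFree_sub`).
[cite: Grimmett2006, Thm. (5.17), eq. (5.18), p. 102] -/
theorem IsBoxLimit.tendsto_freePair_add_cofinite_of_fkGibbs (hP : IsBoxLimit d false (fkIsingParam β) 2 P)
    (hβ : 0 ≤ β) (hG : FKGibbs d (fkIsingParam β) 2 P) (x : Site d) :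
    Tendsto (fun u : Site d => freePair d β x (x + u)) cofinite (𝓝 (thetaFree d (fkIsingParam β) 2 ^ 2)) := by
  refine (hP.tendsto_twoPointFree_cofinite_of_fkGibbs hβ hG).congr fun u => ?_
  rw [freePair_eq_twoPointFree_sub hβ, add_sub_cancel_left]

end ModuloDLR

/-! ### The canonical free FK–Ising measure `φ⁰_{p,2} = rcLimit d false p 2`: (5.18) unconditionally (appended)

With `InfiniteVolumeDLR.lean` (row FO-06a-2: `IsBoxLimit.fkGibbs`, the DLR sandwich of every box limit, Grimmett
2006 Lemma (4.13) with (4.14)(b) in the limit) in the tree, the last hypothesis is discharged for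
`P = φ⁰_{p,2} = rcLimit d false (1 - e^{-2β}) 2` (`isBoxLimit_rcLimit`, Thm. (4.19)(a)). -/

section Canonical

variable {β : ℝ}

/-- **`θ⁰(1 - e^{-2β}, 2)² ≤ ⟨σ_xσ_y⟩^∅_{β,0}` for all `x, y`** (`β ≥ 0`), unconditionally: the lower half of
(5.32), pointwise, for `φ⁰_{p,2}`. [cite: Grimmett2006, Thm. (5.17), proof of (5.18), (5.32), p. 107] -/
theorem thetaFree_sq_le_freePair (hβ : 0 ≤ β) (x y : Site d) :
    thetaFree d (fkIsingParam β) 2 ^ 2 ≤ freePair d β x y :=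
  have hp := fkIsingParam_mem_Icc hβ
  have hq : (1 : ℝ) ≤ 2 := by norm_num
  (isBoxLimit_rcLimit false hp hq).thetaFree_sq_le_freePair_of_fkGibbs hβ
    ((isBoxLimit_rcLimit false hp hq).fkGibbs hp hq) x y

/-- **`M̃_LRO(β)² = θ⁰(1 - e^{-2β}, 2)²` on `ℤ^d`, `d ≥ 1`, `β ≥ 0`, unconditionally** — Grimmett 2006,
Thm. (5.17) eq. (5.18) at `q = 2` in the Cesàro normalisation of ADS15 §1.3 (1.9): the variant long-range
order parameter of the free Ising state IS the percolation probability of the free FK–Ising measure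
`φ⁰_{p,2}`. Inputs, all for `φ⁰_{p,2} = rcLimit d false p 2`: Thm. (4.19)(a)–(b) (`isBoxLimit_rcLimit`,
`IsBoxLimit.measurePreserving_relabel_shift`), Lemma (4.13)/(4.14)(b) (`IsBoxLimit.fkGibbs`), Thm. (4.33)(c)
(`IsBoxLimit.ae_numInfiniteClusters_le_one`), Thm. (4.91) and (5.1).
[cite: Grimmett2006, Thm. (5.17), eq. (5.18), p. 102 (proof p. 107)] [cite: AizenmanDuminilCopinSidoraviciusCMP2015, §1.3, eq. (1.9)] -/
theorem lroTildeSq_eq_thetaFree_sq (hd : 1 ≤ d) (hβ : 0 ≤ β) :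
    lroTildeSq d β = thetaFree d (fkIsingParam β) 2 ^ 2 :=
  have hp := fkIsingParam_mem_Icc hβ
  have hq : (1 : ℝ) ≤ 2 := by norm_num
  (isBoxLimit_rcLimit false hp hq).lroTildeSq_eq_thetaFree_sq_of_fkGibbs hd hβ
    ((isBoxLimit_rcLimit false hp hq).fkGibbs hp hq)

/-- **`M̃_LRO(β) = θ⁰(1 - e^{-2β}, 2)`** (`d ≥ 1`, `β ≥ 0`), square roots taken: `√(M̃_LRO(β)²) = θ⁰(p,2)`.
[cite: Grimmett2006, Thm. (5.17), eq. (5.18), p. 102] -/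
theorem sqrt_lroTildeSq_eq_thetaFree (hd : 1 ≤ d) (hβ : 0 ≤ β) :
    Real.sqrt (lroTildeSq d β) = thetaFree d (fkIsingParam β) 2 := by
  rw [lroTildeSq_eq_thetaFree_sq hd hβ, Real.sqrt_sq (thetaFree_nonneg _ _)]

/-- **At the critical point: `M̃_LRO(β_c)² = θ⁰(p_c(2), 2)²`** on `ℤ^d`, `d ≥ 2` (`p_c(2) = 1 - e^{-2β_c}`,
the tree's `rcCriticalProb_two_eq_fkIsingParam_criticalBeta`): ADS15's order parameter at criticality is the
free FK–Ising percolation probability at the self-same critical point — the quantitative form behind the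
zero-form dictionary `FKContinuityFree d 2 ↔ lroTildeSq d (criticalBeta d) = 0` of `ContinuityTransferTwo.lean`.
[cite: Grimmett2006, Thm. (5.17), eq. (5.18), p. 102] [cite: AizenmanDuminilCopinSidoraviciusCMP2015, Thm. 1.2 and §1.3 eq. (1.9)] -/
theorem lroTildeSq_criticalBeta_eq_thetaFree_rcCriticalProb_sq (hd : 2 ≤ d) :
    lroTildeSq d (criticalBeta d) = thetaFree d (rcCriticalProb d 2) 2 ^ 2 := by
  rw [rcCriticalProb_two_eq_fkIsingParam_criticalBeta hd]
  exact lroTildeSq_eq_thetaFree_sq (by omega) (criticalBeta_nonneg d)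

/-- **Grimmett 2006, Thm. (5.17) eq. (5.18) at `q = 2`, literally and unconditionally:
`⟨σ_0σ_u⟩^∅_{β,0} → θ⁰(1 - e^{-2β}, 2)²` as `|u| → ∞` in `ℤ^d`** (`β ≥ 0`; i.e.
`½ θ⁰(p,2)² = lim_{|u|→∞} {π_β(σ_0 = σ_u) - ½}` with `π_β(σ_0 = σ_u) - ½ = ½⟨σ_0σ_u⟩`), for
`φ⁰_{p,2} = rcLimit d false p 2`. [cite: Grimmett2006, Thm. (5.17), eq. (5.18) and its proof, (5.32), p. 107] -/
theorem tendsto_twoPointFree_cofinite_thetaFree_sq (hβ : 0 ≤ β) :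
    Tendsto (twoPointFree d β) cofinite (𝓝 (thetaFree d (fkIsingParam β) 2 ^ 2)) :=
  have hp := fkIsingParam_mem_Icc hβ
  have hq : (1 : ℝ) ≤ 2 := by norm_num
  (isBoxLimit_rcLimit false hp hq).tendsto_twoPointFree_cofinite_of_fkGibbs hβ
    ((isBoxLimit_rcLimit false hp hq).fkGibbs hp hq)

/-- The pair-correlation form: `⟨σ_xσ_{x+u}⟩^∅_{β,0} = freePair d β x (x + u) → θ⁰(p,2)²` as `|u| → ∞`, for
every base point `x`. [cite: Grimmett2006, Thm. (5.17), eq. (5.18), p. 102] -/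
theorem tendsto_freePair_add_cofinite_thetaFree_sq (hβ : 0 ≤ β) (x : Site d) :
    Tendsto (fun u : Site d => freePair d β x (x + u)) cofinite (𝓝 (thetaFree d (fkIsingParam β) 2 ^ 2)) :=
  have hp := fkIsingParam_mem_Icc hβ
  have hq : (1 : ℝ) ≤ 2 := by norm_num
  (isBoxLimit_rcLimit false hp hq).tendsto_freePair_add_cofinite_of_fkGibbs hβ
    ((isBoxLimit_rcLimit false hp hq).fkGibbs hp hq) x

/-- **The free Ising two-point function has a limit at infinity, and it is `M̃_LRO(β)²`:
`⟨σ_0σ_u⟩^∅_{β,0} → M̃_LRO(β)²` as `|u| → ∞`** (`d ≥ 1`, `β ≥ 0`) — ADS15 §1.3 (1.9)–(1.10) with the `inf`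
over blocks realised as an honest limit, through (5.18). [cite: AizenmanDuminilCopinSidoraviciusCMP2015, §1.3, eqs. (1.9)–(1.10)] [cite: Grimmett2006, Thm. (5.17), eq. (5.18)] -/
theorem tendsto_twoPointFree_cofinite_lroTildeSq (hd : 1 ≤ d) (hβ : 0 ≤ β) :
    Tendsto (twoPointFree d β) cofinite (𝓝 (lroTildeSq d β)) := by
  rw [lroTildeSq_eq_thetaFree_sq hd hβ]
  exact tendsto_twoPointFree_cofinite_thetaFree_sq hβ

/-- **`M̃_LRO(β)² ≤ m*(β)²`** (`d ≥ 1`, `β ≥ 0`): `M̃_LRO² = θ⁰(p,2)² ≤ θ¹(p,2)² = m*(β)²` (Grimmett 2006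
(5.18)–(5.19) with `φ⁰ ≤ φ¹`), sharpening row FO-04's `FK.lroTildeSq_le_spontaneousMagnetization`
(`M̃_LRO² ≤ m*`); compare ADS15 Prop. 1.1 (`M_LRO ≤ m*`).
[cite: Grimmett2006, Thm. (5.17), eqs. (5.18)–(5.19), p. 102] [cite: AizenmanDuminilCopinSidoraviciusCMP2015, Prop. 1.1] -/
theorem lroTildeSq_le_spontaneousMagnetization_sq (hd : 1 ≤ d) (hβ : 0 ≤ β) :
    lroTildeSq d β ≤ spontaneousMagnetization d β ^ 2 := by
  rw [lroTildeSq_eq_thetaFree_sq hd hβ, ← thetaWired_fkIsingParam_two_eq_spontaneousMagnetization (by omega) hβ]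
  exact pow_le_pow_left₀ (thetaFree_nonneg _ _)
    (thetaFree_le_thetaWired (fkIsingParam_mem_Icc hβ) (by norm_num)) 2

end Canonical

end FK

end Summit.CriticalPhenomena.PercolationContinuityZ3.Theorems

end
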